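import Summits.AnomalousDissipation.AnomalousDissipation.Theorems.ScalarZerothLawKinematicDefs
import Summits.AnomalousDissipation.AnomalousDissipation.Theorems.ScalarZerothLawKinematicFloor
import Summits.AnomalousDissipation.AnomalousDissipation.Theorems.ScalarZerothLawKinematicCarrier
import Summits.AnomalousDissipation.AnomalousDissipation.Theorems.ScalarZerothLawKinematicExistence
import HarnessLib

/-!
# The scalar zeroth law in the long-time frame over a prescribed carrier, from Hess-Childs–Rowan

Cell `ad-ideate`, planner ad-ideate-p1 ROUND-10 §B / ROUND-11 §2 (the consumer of the (P2) "diag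
parabolic layer" T1–T4): the planner's `Target`,

  `HessChildsRowan2025a_cor13 → ScalarZerothLawQuant`

(`scalarZerothLawQuant_of_cor13`), and the bookkeeping `ScalarZerothLawQuant → ScalarZerothLawLongTime`
(`scalarZerothLawLongTime_of_quant`). GIVEN the named Literature fact `HessChildsRowan2025a_cor13`
(Hess-Childs–Rowan, arXiv:2501.18526, Cor. 1.3: the forward–backward field `W` of their universal
total dissipator contracts EVERY mean-zero `L²` datum by `C κ^{(1-α)²/72}` at time `1`, uniformly in
the datum), the `L`-periodised carrier `b_L(t) = W(L·fract(t/L))` (one burst per period, quiet on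
`[nL+1,(n+1)L]`) realises, for every smooth mean-zero steady source `S`, all `κ ≤ κ₀(α, L, S)`, ALL
mean-zero `L²` data and EVERY global weak solution of `∂ₜθ + b_L·∇θ = κ(½∂₀² + ∂₁²)θ + S`:
(E∞) `‖θ(t)‖ ≤ ‖θ₀‖ + 3L‖S‖` a.e., (E) `⟨‖θ‖²⟩⁺ ≤ 9L²‖S‖²`, (D) `⟨κ‖∇θ‖²⟩₋ ≥ (L/2 - 5)‖S‖²`.

Proof = ROUND-10 §B3 Steps 1–5 on the strongly `L²`-continuous representative of `θ`
(`IsWeakScalarTransportDiagForced.exists_l2Continuous_representative`, the T1 energy layer), the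
`L²` existence of the homogeneous problem (T2), restarts at the period boundaries (T3), the energy
equality (T1) and the Duhamel bound: files `ScalarZerothLawKinematic{Averages,Budget,Carrier,Period,
Injection,Dissipation,Energy,Floor}.lean`; NON-VACUITY of the solution class (global `L²`-continuous
weak solutions exist for every stirring carrier, smooth source and `L²` datum) is
`exists_solution_of_isStirringCarrier_of_isSmooth` (`ScalarZerothLawKinematicExistence.lean`, the
T2 forced-existence layer). The result is CONDITIONAL on `HessChildsRowan2025a_cor13`
(a named, unproved Literature fact) and is the prescribed-carrier (kinematic) rung next to the
TwoAndHalfD crux `ScalarAnomalySteadySourceFormal` (stmt-AnomalousDissipation-0448, NS-generated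
carriers); it is not a statement about Navier–Stokes. Supports stmt-AnomalousDissipation-0448.
-/

noncomputable section

-- `Summit.<Summit>.<Problem>` is the tree's mandated summit-side namespace (CONVENTIONS §2); for this
-- single-conjunct summit the two coincide, so the duplicate is deliberate.
set_option linter.dupNamespace false

namespace Summit.AnomalousDissipation.AnomalousDissipation.Theorems.ScalarZerothLawKinematic

open MeasureTheory Set Filter Topology
open scoped NNReal ENNReal InnerProductSpace
open Literature.Analysis Literature.Analysis.FluidPDE Literature.Analysis.FunctionSpaces
open Literature.Analysis.FluidPDE.Torus Literature.Analysis.FunctionSpaces.Torus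
open Literature.Analysis.FluidPDE.HessChildsRowan2025a

/-! ## The diffusion coefficients `(½, 1)` of the Hess-Childs–Rowan rendering -/

/-- The coefficients `(½, 1)` are at most `1`. -/
theorem halfOne_le_one : ∀ i : Fin 2, (![2⁻¹, 1] : Fin 2 → ℝ) i ≤ 1 := by
  intro i; fin_cases i <;> norm_num

/-- The coefficients `(½, 1)` are at least `½`. -/
theorem half_le_halfOne : ∀ i : Fin 2, (2⁻¹ : ℝ) ≤ (![2⁻¹, 1] : Fin 2 → ℝ) i := by
  intro i; fin_cases i <;> norm_num

/-- A continuous scalar on the torus is in `L²`. -/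
theorem memLp_two_of_continuous {d : Type*} [Fintype d] {f : UnitAddTorus d → ℝ} (hf : Continuous f) :
    MemLp f 2 volume := by
  obtain ⟨C, hC⟩ := FunctionSpaces.Torus.exists_forall_norm_le_of_continuous hf
  exact (memLp_top_of_bound hf.aestronglyMeasurable C (Eventually.of_forall hC)).mono_exponent le_top

/-! ## Transfer of long-time means between a.e.-equal fields -/

/-- Two time functions agreeing for a.e. `t > 0` have the same `⟨·⟩⁺`. -/
theorem longTimeAvgSup_congr_ae {f g : ℝ → ℝ} (h : ∀ᵐ t ∂(volume.restrict (Ioi (0 : ℝ))), f t = g t) :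
    longTimeAvgSup f = longTimeAvgSup g := by
  rw [longTimeAvgSup, longTimeAvgSup]
  refine limsup_congr ?_
  filter_upwards [eventually_ge_atTop (0 : ℝ)] with T hT
  exact timeMean_congr_ae h hT

/-- Two time functions agreeing for a.e. `t > 0` have the same `⟨·⟩₋`. -/
theorem longTimeAvgInf_congr_ae {f g : ℝ → ℝ} (h : ∀ᵐ t ∂(volume.restrict (Ioi (0 : ℝ))), f t = g t) :
    longTimeAvgInf f = longTimeAvgInf g := by
  rw [longTimeAvgInf, longTimeAvgInf]
  refine liminf_congr ?_
  filter_upwards [eventually_ge_atTop (0 : ℝ)] with T hT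
  exact timeMean_congr_ae h hT

/-! ## The target -/

/-- **The scalar zeroth law in the long-time frame over a prescribed carrier, explicit form, from
Hess-Childs–Rowan Cor. 1.3** (ad-ideate-p1 ROUND-10 §B, `Target`). For every `α ∈ (0,1)` and
`L ≥ 12`, the `L`-periodised forward–backward field `b_L(t) = W(L·fract(t/L))` of the
Hess-Childs–Rowan carrier is a stirring carrier, silent on `[nL + 1, (n+1)L]`, and for every smooth
mean-zero steady source `S` there is `κ₀ > 0` (from the contraction constant, `L` and
`‖∑ᵢaᵢ∂ᵢ∂ᵢS‖/‖S‖`) such that for all `κ ∈ (0,κ₀]`, all mean-zero `L²` data and EVERY global weak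
solution: (E∞) `‖θ(t)‖² ≤ (‖θ₀‖ + 3L‖S‖)²` for a.e. `t ∈ (0,T)`; (E) `⟨‖θ‖²⟩⁺ ≤ 9L²‖S‖²`;
(D) `(L/2 - 5)‖S‖² ≤ ⟨κ‖∇θ‖²⟩₋`. Conditional on the named fact `HessChildsRowan2025a_cor13`. -/
theorem scalarZerothLawQuant_of_cor13 (hcor : HessChildsRowan2025a_cor13) : ScalarZerothLawQuant := by
  intro α hα0 hα1 L hL
  have hL0 : 0 < L := by linarith
  have hL1 : 1 < L := by linarith
  obtain ⟨V, hV, -, hWdiss⟩ := hcor α hα0 hα1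
  obtain ⟨A, hVA, -, -⟩ := hV.exists_const
  refine ⟨fun t x => forwardBackwardField V (Int.fract (t / L) * L) x, periodize_carrier hV hL0, ?_, ?_⟩
  · intro n t h1 h2
    exact forwardBackwardField_fract_eq_zero hL0 n h1 h2
  intro S hS hS0
  -- the drift: bounded by `8A`, equal to `W` on the active units, zero on the quiet parts
  have hbA : ∀ (t : ℝ) (x : UnitAddTorus (Fin 2)),
      ‖(fun t x => forwardBackwardField V (Int.fract (t / L) * L) x) t x‖ ≤ 8 * A :=
    fun t x => norm_forwardBackwardField_le hVA _ x
  have hbW : ∀ (n : ℕ), ∀ t ∈ Ioo (0 : ℝ) 1,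
      (fun t x => forwardBackwardField V (Int.fract (t / L) * L) x) ((n : ℝ) * L + t) =
        forwardBackwardField V t := by
    intro n t ht
    funext x
    show forwardBackwardField V (Int.fract (((n : ℝ) * L + t) / L) * L) x = forwardBackwardField V t x
    rw [fract_div_mul_natCast_mul_add hL0 n ⟨ht.1.le, ht.2.trans hL1⟩]
  have hb0 : ∀ (n : ℕ) (t : ℝ), (n : ℝ) * L + 1 < t → t < ((n : ℝ) + 1) * L →
      (fun t x => forwardBackwardField V (Int.fract (t / L) * L) x) t = 0 := by
    intro n t h1 h2
    have := forwardBackwardField_fract_eq_zero (V := V) hL0 (n : ℤ) (t := t)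
      (by push_cast; exact h1.le) (by push_cast; exact h2.le)
    exact this
  -- the contraction constant of `W` and the diffusivity threshold
  obtain ⟨C, hC, hHCR0⟩ := hWdiss.scalarL2Sq_one_le
  set γ : ℝ := (1 - (α : ℝ)) ^ 2 / 72 with hγ
  have hγ0 : 0 < γ := by
    have : (α : ℝ) < 1 := by exact_mod_cast hα1
    have h1 : 0 < 1 - (α : ℝ) := by linarith
    positivity
  have hS2 : MemLp S 2 volume := hS.memLp 2
  have hSmean : ∫ x, S x = 0 := hS0
  set σ : ℝ := Real.sqrt (∫ x, S x ^ 2) with hσdef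
  have hσ : 0 ≤ σ := Real.sqrt_nonneg _
  -- the diagonal operator applied to the source
  have hASc : Continuous fun x => ∑ i, (![2⁻¹, 1] : Fin 2 → ℝ) i *
      FunctionSpaces.Torus.partialDeriv i (FunctionSpaces.Torus.partialDeriv i S) x :=
    continuous_finsetSum _ fun i _ => continuous_const.mul ((hS.partialDeriv i).partialDeriv i).continuous
  have hKm := memLp_two_of_continuous hASc
  set K : ℝ := Real.sqrt (∫ x, (∑ i, (![2⁻¹, 1] : Fin 2 → ℝ) i *
      FunctionSpaces.Torus.partialDeriv i (FunctionSpaces.Torus.partialDeriv i S) x) ^ 2) with hKdef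
  have hK0 : 0 ≤ K := Real.sqrt_nonneg _
  set κ₁ : ℝ := (1 / (2 * C * L)) ^ γ⁻¹ with hκ₁
  have hκ₁0 : 0 < κ₁ := Real.rpow_pos_of_pos (by positivity) _
  set κ₂ : ℝ := if 0 < σ then σ / (K * L ^ 2 + 1) else 1 with hκ₂
  have hκ₂0 : 0 < κ₂ := by
    rw [hκ₂]; split_ifs with h
    · positivity
    · exact one_pos
  refine ⟨min κ₁ κ₂, lt_min hκ₁0 hκ₂0, ?_⟩
  intro κ hκ hκle θ₀ hθ₀ hθ₀mean θ hθ
  -- the contraction factor `q = C κ^γ ≤ 1/(2L)`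
  set q : ℝ := C * κ ^ γ with hqdef
  have hq0 : 0 ≤ q := by positivity
  have hqL : q * (2 * L) ≤ 1 := by
    have hκ1 : κ ≤ κ₁ := hκle.trans (min_le_left _ _)
    have h1 : κ ^ γ ≤ κ₁ ^ γ := Real.rpow_le_rpow hκ.le hκ1 hγ0.le
    have h2 : κ₁ ^ γ = 1 / (2 * C * L) := by
      rw [hκ₁]; exact Real.rpow_inv_rpow (by positivity) hγ0.ne'
    rw [h2] at h1
    calc q * (2 * L) = C * κ ^ γ * (2 * L) := rfl
      _ ≤ C * (1 / (2 * C * L)) * (2 * L) := by gcongr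
      _ = 1 := by field_simp
  -- the diffusivity restriction `κ K L² σ ≤ σ²`
  have hκK : κ * K * L ^ 2 * σ ≤ σ ^ 2 := by
    have hκ2 : κ ≤ κ₂ := hκle.trans (min_le_right _ _)
    rw [hκ₂] at hκ2
    split_ifs at hκ2 with hpos
    · have h1 : κ * (K * L ^ 2 + 1) ≤ σ := by rwa [le_div_iff₀ (by positivity)] at hκ2
      have h2 : κ * K * L ^ 2 ≤ σ := by nlinarith
      calc κ * K * L ^ 2 * σ ≤ σ * σ := mul_le_mul_of_nonneg_right h2 hσ
        _ = σ ^ 2 := (sq σ).symm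
    · have hσ0 : σ = 0 := le_antisymm (not_lt.1 hpos) hσ
      rw [hσ0]; simp
  -- the Hess-Childs–Rowan contraction in the form used along the periods
  have hHCR : ∀ η₀ : UnitAddTorus (Fin 2) → ℝ, MemLp η₀ 2 volume → ∫ x, η₀ x = 0 →
      ∀ η : ℝ → UnitAddTorus (Fin 2) → ℝ, IsWeakScalarTransportDiagOn 1 ![2⁻¹, 1] κ
        (forwardBackwardField V) η₀ η → IsL2ContinuousOn (Icc 0 1) η →
        Torus.scalarL2Sq (η 1) ≤ q ^ 2 * Torus.scalarL2Sq η₀ :=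
    fun η₀ h1 h2 η h3 h4 => hHCR0 κ hκ η₀ h1 h2 η h3 h4
  -- the strongly `L²`-continuous representative
  have hu : ∀ T : ℝ, 0 < T → MemLp (stLift fun t x => forwardBackwardField V (Int.fract (t / L) * L) x) ⊤
      (volume.restrict (Ioo 0 T ×ˢ univ)) := fun T hT => memLp_top_drift hθ hbA hT
  have hs : ∀ T : ℝ, 0 < T → ∫⁻ _ in Ioo 0 T, (∫⁻ x, ‖S x‖ₑ ^ 2) ^ (1 / 2 : ℝ) < ⊤ :=
    fun T _ => lintegral_steady_source_lt_top hS2 T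
  obtain ⟨w, hw, hwc, hw0, hwae, -, -⟩ := hθ.exists_l2Continuous_representative hκ diagCoeff_pos hθ₀ hu hs
  -- the three conjuncts along `w`
  have hEinf := fun t (ht : 0 ≤ t) => sqrt_integral_sq_le_uniform hw hwc hκ diagCoeff_pos hθ₀ hθ₀mean hSmean
    hS hbA hq0 hqL hHCR hbW hL hw0 ht
  have hE := longTimeAvgSup_integral_sq_le hw hwc hκ diagCoeff_pos hθ₀ hθ₀mean hSmean hS hbA hq0 hqL hHCR hbW hL
  have hD := le_longTimeAvgInf_dissipation hw hwc hκ diagCoeff_pos halfOne_le_one (by norm_num : (0 : ℝ) < 2⁻¹)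
    half_le_halfOne hθ₀ hθ₀mean hSmean hS hbA hq0 hqL hHCR hbW hb0 hL hKm le_rfl hκK hw0
  -- transfer to `θ`
  have hae_sq : ∀ᵐ t ∂(volume.restrict (Ioi (0 : ℝ))), Torus.scalarL2Sq (θ t) = Torus.scalarL2Sq (w t) := by
    filter_upwards [hwae] with t ht
    exact integral_congr_ae (ht.mono fun x hx => by simp only [hx])
  have hae_grad : ∀ᵐ t ∂(volume.restrict (Ioi (0 : ℝ))),
      κ * (Torus.eScalarGradNormSq (θ t)).toReal = κ * (Torus.eScalarGradNormSq (w t)).toReal := by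
    filter_upwards [hwae] with t ht
    rw [eScalarGradNormSq_congr_ae ht.symm]
  refine ⟨fun T hT => ?_, ?_, ?_⟩
  · filter_upwards [ae_restrict_of_ae_restrict_of_subset Ioo_subset_Ioi_self hae_sq,
      ae_restrict_mem measurableSet_Ioo] with t ht htI
    rw [ht]
    have h := hEinf t htI.1.le
    have e : Torus.scalarL2Sq (w t) = Real.sqrt (∫ x, w t x ^ 2) ^ 2 :=
      (Real.sq_sqrt (integral_nonneg fun x => sq_nonneg _)).symm
    rw [e]
    exact pow_le_pow_left₀ (Real.sqrt_nonneg _) h 2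
  · rw [longTimeAvgSup_congr_ae hae_sq]
    exact hE
  · rw [longTimeAvgInf_congr_ae hae_grad]
    exact hD

/-- **Bookkeeping: the explicit form gives the qualitative scalar zeroth law** (`L = 12`,
`E = 9·144·‖S‖²`, `ε = ‖S‖² > 0` for a smooth `S ≢ 0`). -/
theorem scalarZerothLawLongTime_of_quant (h : ScalarZerothLawQuant) : ScalarZerothLawLongTime := by
  intro α hα0 hα1
  obtain ⟨b, hb, -, hmain⟩ := h α hα0 hα1 12 le_rfl
  refine ⟨12, b, by norm_num, hb, fun S hS hS0 hSne => ?_⟩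
  obtain ⟨κ₀, hκ₀, hκ⟩ := hmain S hS hS0
  -- a smooth `S ≢ 0` has `‖S‖² > 0`
  have hσpos : 0 < Torus.scalarL2Sq S := by
    obtain ⟨x₀, hx₀⟩ := hSne
    have hc : Continuous fun x => S x ^ 2 := hS.continuous.pow 2
    have hnn : 0 ≤ fun x => S x ^ 2 := fun x => sq_nonneg _
    have hpos : 0 < ∫ x, S x ^ 2 := by
      rw [integral_pos_iff_support_of_nonneg hnn ((hS.memLp 2).integrable_sq)]
      refine (hc.isOpen_support.measure_pos volume ⟨x₀, ?_⟩)
      simp only [Function.mem_support]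
      exact pow_ne_zero 2 hx₀
    exact hpos
  refine ⟨9 * 12 ^ 2 * Torus.scalarL2Sq S, Torus.scalarL2Sq S, κ₀, hσpos, hκ₀, ?_⟩
  intro κ hκpos hκle θ₀ hθ₀ hmean θ hθ
  obtain ⟨-, hE, hD⟩ := hκ κ hκpos hκle θ₀ hθ₀ hmean θ hθ
  refine ⟨hE, le_trans ?_ hD⟩
  have : (12 : ℝ) / 2 - 5 = 1 := by norm_num
  rw [this, one_mul]

/-- **The qualitative scalar zeroth law over a prescribed carrier, from Hess-Childs–Rowan Cor. 1.3.**
Conditional on the named fact `HessChildsRowan2025a_cor13`. -/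
theorem scalarZerothLawLongTime_of_cor13 (hcor : HessChildsRowan2025a_cor13) : ScalarZerothLawLongTime :=
  scalarZerothLawLongTime_of_quant (scalarZerothLawQuant_of_cor13 hcor)

end Summit.AnomalousDissipation.AnomalousDissipation.Theorems.ScalarZerothLawKinematic

end
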